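import Summits.NavierStokesRegularity.NavierStokesRegularity.Theorems.ArgmaxNearDoorsDefs
import Summits.NavierStokesRegularity.NavierStokesRegularity.Theorems.ArgmaxDoorsThreshold
import Summits.NavierStokesRegularity.NavierStokesRegularity.Theorems.ArgmaxDoorsDepletionLocal
import HarnessLib

/-!
# IncrementDoorsDefs — door S36-K «IncrementDoor» (two-point Kiselev–Nazarov–Volberg engine for the vorticity vector):
# texts of record (plate P0-36B), §B0–§B2 of nsreg-p1 g30's `r34/Sketch36.lean` v2 sha16 f0fe6d26e287c4b8 VERBATIM

Statement-only file (definitions; no theorem): objects `IsModulusProfile`, `HasVorticityModulus`, `modScale`, `barrier`,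
`farDepletionIntegral`, `pairCharge`, `pairCredit`; door `IncrementDoor`; plates K `IncrementEngine`, D♯ `NearFarSplit`,
P `ModulusProfileExists`.  The kernel-checked composition `incrementDoor_of` (§B3) lands separately in
`Theorems/IncrementDoorsCompositions.lean` (the gate caps files WITH proofs at 400 lines).  Landed by ns-s29-p2 g4 on LEAD
ns-s30-p1 g3's key 2026-08-28T17:28:24Z (c), ROUND-34 08b22d05361083d7; `--supports stmt-NavierStokesRegularity-0056 --as helper`,
`--kind definition`.  The sketch's §B module docstring follows verbatim.  Plate D♯ is PROVED (ns-sfl-p1 g5 `nearFarSplit`,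
`…ArgmaxNearDoorsSplit` p652373, δ-unfolded twin); P is PROVED (`…IncrementDoorsProfile`); K «IncrementEngine» is ON HOLD
(planner's honest caveat, director-ns g16 concurring) — so the door S36-K is NOT closed by these files.

WHAT THIS IS NOT: a regularity CRITERION about hypothetical blow-up (two-point modulus + size barrier ⇒ continuation);
item 0056 `NoTypeII` and NS regularity are NOT proved; nothing here is a route or a summit statement.
-/

/-! # §B — door S36-K «IncrementDoor»: a TWO-POINT (Kiselev–Nazarov–Volberg) breakthrough engine for the
vorticity VECTOR (nsreg-p1 g30, ROUND-34 §B; typed for the record — see the memo's value caveat)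

The object: a time-dependent two-point MODULUS `|ω(x,t) − ω(y,t)| ≤ b(t)·Θ(|x − y|/λ(t))` at the SUB-PARABOLIC
scale `λ(t) = R√(ν(T − t))`, with an UNBOUNDED concave profile `Θ` (`Θ(0) = 0`, `0 < Θ' ≤ 1`, `Θ'' < 0`,
`Θ''(0+) = −∞`, `Θ → ∞`), carried together with the SIZE conjunct `‖ω(t)‖_∞ ≤ b(t)`. At a breakthrough PAIR the
vorticity equation, with the direction `e = δω/|δω|` FROZEN, is a scalar equation to which the KNV two-point
maximum principle applies: viscosity pays `4ν b Θ''(ρ)/λ²` (a GAIN, `Θ'' < 0`), the shrinking scale pays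
`b ρΘ'(ρ)|λ'|/λ`, transport costs `(bΘ'/λ)|⟪δu, r̂⟫|`, stretching costs `⟪δω, δS⟫/|δω|` (`S = (∇u)ω`). Because
`Θ` is unbounded and `|δω| ≤ 2‖ω‖_∞ ≤ 2b`, breakthroughs only happen at separations `ρ ≤ Θ⁻¹(2)`: the pair
hypothesis is PARABOLIC-LOCAL. The size face is an argmax touch `|ω(x̄,t)| = b(t)`, charged through
Constantin–Fefferman's depletion with the NEAR FIELD READ OFF THE MODULUS (`|ω(y) − ω(x̄)| ≤ b|y − x̄|/λ`): only
the far field beyond `θλ` and the explicit near charge `4πAθ|ω(x̄)|` appear.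
(A bounded profile `Θ → 1` would make the door parasitic: its `ρ = ∞` tail is the uncredited one-point door at
the barrier — memo §9.) -/

noncomputable section

open MeasureTheory Set Function Filter Metric Real InnerProductSpace
open _root_.Topology
open scoped ENNReal NNReal RealInnerProductSpace ContDiff
open Literature.Analysis Literature.Analysis.FluidPDE
open Literature.Analysis.FluidPDE.VorticityDirectionDynamics

set_option linter.dupNamespace false

namespace Summit.NavierStokesRegularity.NavierStokesRegularity.Theorems.IncrementDoors

open Summit.NavierStokesRegularity.NavierStokesRegularity.Theorems.ArgmaxDoors

set_option maxSynthPendingDepth 3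

/-! ## §B0 Objects -/

/-- support (definition): the admissible MODULUS PROFILES `Θ` with first/second derivatives `Θ', Θ''` on
`(0,∞)`: `Θ(0) = 0`, right-continuous at `0`, `C²` on `(0,∞)`, `Θ > 0`, `0 < Θ' ≤ 1`, `Θ'' < 0` there,
`Θ''(0+) = −∞` (the KNV gradient lemma: a function with such a modulus has `|∇f| < bΘ'(0+)/λ` STRICTLY),
`0 ≤ Θ(ρ) ≤ ρ`, and `Θ → ∞` (UNBOUNDED: no far face). Example: `Θ(ρ) = ∫₀^ρ ds/((1+√s)√(1+s))`. -/
def IsModulusProfile (Θ Θ' Θ'' : ℝ → ℝ) : Prop :=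
  Θ 0 = 0 ∧ ContinuousWithinAt Θ (Ici 0) 0 ∧
  (∀ ρ : ℝ, 0 < ρ → HasDerivAt Θ (Θ' ρ) ρ ∧ HasDerivAt Θ' (Θ'' ρ) ρ) ∧
  (∀ ρ : ℝ, 0 < ρ → 0 < Θ ρ ∧ 0 < Θ' ρ ∧ Θ' ρ ≤ 1 ∧ Θ'' ρ < 0) ∧
  Tendsto Θ'' (𝓝[>] 0) atBot ∧
  (∀ ρ : ℝ, 0 ≤ ρ → 0 ≤ Θ ρ ∧ Θ ρ ≤ ρ) ∧
  Tendsto Θ atTop atTop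

/-- support (definition): the two-point MODULUS WITH SIZE at time `t`, amplitude `b`, scale `l`:
`|ω(x,t) − ω(y,t)| ≤ b·Θ(|x−y|/l)` for all `x, y`, and `|ω(x,t)| ≤ b` for all `x`. -/
def HasVorticityModulus (u : ℝ → (EuclideanSpace ℝ (Fin 3)) → (EuclideanSpace ℝ (Fin 3))) (Θ : ℝ → ℝ)
    (t b l : ℝ) : Prop :=
  (∀ x y, ‖curl (u t) x - curl (u t) y‖ ≤ b * Θ (‖x - y‖ / l)) ∧ ∀ x, ‖curl (u t) x‖ ≤ b

/-- support (definition): the SUB-PARABOLIC modulus scale `λ(t) = R√(ν(T − t))`. -/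
def modScale (ν T R t : ℝ) : ℝ := R * Real.sqrt (ν * (T - t))

/-- support (definition): the barrier amplitude `B(t) = ε/(T−t) + c(T−t)^{−a}` (doors B/C/C♭ family). -/
def barrier (T a ε c t : ℝ) : ℝ := ε / (T - t) + c * (T - t) ^ (-a)

/-- support (definition): the FAR-FIELD DEPLETION INTEGRAL beyond radius `r` seen from `x`:
`∫_{|y−x| ≥ r} |ω(y) − ⟪ω(y),ξ(x)⟫ξ(x)| |x−y|⁻³ dy`. -/
def farDepletionIntegral (u : ℝ → (EuclideanSpace ℝ (Fin 3)) → (EuclideanSpace ℝ (Fin 3))) (t : ℝ)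
    (x : EuclideanSpace ℝ (Fin 3)) (r : ℝ) : ℝ :=
  ∫ y in (ball x r)ᶜ, ‖curl (u t) y - ⟪curl (u t) y, vorticityDirection (curl (u t)) x⟫ •
      vorticityDirection (curl (u t)) x‖ * (‖x - y‖ ^ 3)⁻¹

/-- support (definition): the PAIR CHARGE at `(x,y,t)` for the scale `λ = modScale ν T R t`:
`⟪δω, δS⟫/|δω|² + (Θ'(ρ)/(λΘ(ρ)))·|⟪δu, x − y⟫|/|x − y|` (`δω = ω(x) − ω(y)`, `δS = (∇u)ω(x) − (∇u)ω(y)`,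
`δu = u(x) − u(y)`, `ρ = |x−y|/λ`): stretching increment rate + transport cost. -/
def pairCharge (ν T R : ℝ) (Θ Θ' : ℝ → ℝ) (u : ℝ → (EuclideanSpace ℝ (Fin 3)) → (EuclideanSpace ℝ (Fin 3)))
    (t : ℝ) (x y : EuclideanSpace ℝ (Fin 3)) : ℝ :=
  ⟪curl (u t) x - curl (u t) y, fderiv ℝ (u t) x (curl (u t) x) - fderiv ℝ (u t) y (curl (u t) y)⟫ /
      ‖curl (u t) x - curl (u t) y‖ ^ 2 +
    Θ' (‖x - y‖ / modScale ν T R t) / (modScale ν T R t * Θ (‖x - y‖ / modScale ν T R t)) *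
      |⟪u t x - u t y, x - y⟫| / ‖x - y‖

/-- support (definition): the PAIR CREDIT at normalised separation `ρ`: `ρΘ'(ρ)/(2Θ(ρ)) − 4Θ''(ρ)/(R²Θ(ρ))`
(scale-shrink gain + viscous two-point gain; the second is `> 0` and `→ +∞` as `ρ → 0`). -/
def pairCredit (R : ℝ) (Θ Θ' Θ'' : ℝ → ℝ) (ρ : ℝ) : ℝ :=
  ρ * Θ' ρ / (2 * Θ ρ) - 4 * Θ'' ρ / (R ^ 2 * Θ ρ)

/-! ## §B1 Door S36-K «IncrementDoor» -/

/-- door S36-K «IncrementDoor» (regularity criterion; TWO-POINT). There is a universal `A ≥ 0`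
(`PointDepletion`'s) such that: `ν > 0`, `0 ≤ t₁ < T`, `a < 1`, `0 < ε < √3/4`, `c ≥ 0`, `R > 0`, `θ > 0`, an
admissible profile `(Θ,Θ',Θ'')`, `(u,p)` in the frame, `B(t) = ε/(T−t) + c(T−t)^{−a}`, `λ(t) = R√(ν(T−t))`. IF
(H0) at `t₁` the modulus-with-size holds with amplitude `B(t₁)` and scale `λ(t₁)`;
(H1) at every later time and every PAIR `x ≠ y` at parabolic-local separation (`Θ(ρ) ≤ 2`, `ρ = |x−y|/λ(t)`) whose
increment has reached the barrier (`B(t)Θ(ρ) ≤ |ω(x,t) − ω(y,t)|`), the pair charge is subcritical up to the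
credits: `(T − t)·pairCharge ≤ a + ρΘ'(ρ)/(2Θ(ρ)) − 4Θ''(ρ)/(R²Θ(ρ))`;
(H2♭) at every later vorticity ARGMAX `x̄` that has reached the barrier (`B(t) ≤ |ω(x̄,t)|`), the FAR depleted rate
is subcritical: `(T − t)·(A·∫_{|y−x̄| ≥ θλ(t)} |ω(y) − ⟪ω(y),ξ(x̄)⟫ξ(x̄)| |x̄−y|⁻³ dy + 4πAθ|ω(x̄,t)| − ν|∇ξ(x̄)|²_F) ≤ a`;
THEN `u` continues past `T`. ((H0) is always satisfiable by taking `c` large; (H1) without (H2♭), or (H2♭)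
without (H1), gives nothing — no parasitic face; a BOUNDED profile would have one.) -/
def IncrementDoor : Prop :=
  ∃ A : ℝ, 0 ≤ A ∧
  ∀ (ν T t₁ a ε c R θ : ℝ) (Θ Θ' Θ'' : ℝ → ℝ), 0 < ν → 0 ≤ t₁ → t₁ < T → a < 1 → 0 < ε →
    ε < Real.sqrt 3 / 4 → 0 ≤ c → 0 < R → 0 < θ → IsModulusProfile Θ Θ' Θ'' →
    ∀ (u : ℝ → (EuclideanSpace ℝ (Fin 3)) → (EuclideanSpace ℝ (Fin 3)))
      (p : ℝ → (EuclideanSpace ℝ (Fin 3)) → ℝ),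
      IsClassicalNSSolutionOn (Ico 0 T) ν 0 u p →
      (∀ T'' < T, HasBoundedSobolevNormsOn (Icc 0 T'') u) →
      HasVorticityModulus u Θ t₁ (barrier T a ε c t₁) (modScale ν T R t₁) →
      (∀ t ∈ Ioo t₁ T, ∀ x y, x ≠ y → Θ (‖x - y‖ / modScale ν T R t) ≤ 2 →
        barrier T a ε c t * Θ (‖x - y‖ / modScale ν T R t) ≤ ‖curl (u t) x - curl (u t) y‖ →
        (T - t) * pairCharge ν T R Θ Θ' u t x y ≤
          a + pairCredit R Θ Θ' Θ'' (‖x - y‖ / modScale ν T R t)) →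
      (∀ t ∈ Ioo t₁ T, ∀ x, IsVorticityArgmax u t x → barrier T a ε c t ≤ ‖curl (u t) x‖ →
        (T - t) * (A * farDepletionIntegral u t x (θ * modScale ν T R t) +
          4 * π * A * θ * ‖curl (u t) x‖ -
          ν * frobeniusNormSq (fderiv ℝ (vorticityDirection (curl (u t))) x)) ≤ a) →
      HasSobolevExtensionPast ν u T

/-! ## §B2 Plates -/

/-- plate K «IncrementEngine» (L; the TWO-POINT first-touch / breakthrough engine — the vector analogue of the
LEAD's `ArgmaxDoorsSupNorm` / `…Supersolution` / `…AlmostArgmax` files joined to the Kiselev–Nazarov–Volberg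
two-point maximum principle). In the frame (`ν > 0`), on a slab `[t₁,t₂] ⊂ [0,T)`, for an admissible profile, an
amplitude `b > 0` and a scale `l > 0` differentiable on the slab, and an initial modulus-with-size with MARGIN
(`θ₀ < 1`): EITHER the modulus-with-size (amplitude `b(t)`, scale `l(t)`) holds on all of `[t₁,t₂]`, OR at some
`t ∈ (t₁,t₂]` where it still holds there is a BREAKTHROUGH PAIR `x ≠ y` — `|δω| = b(t)Θ(ρ)`, `ρ = |x−y|/l(t)`, and
(left time-derivative ≥ barrier derivative; direction `e = δω/|δω|` frozen; `∇(e·ω)(x) = ∇(e·ω)(y) = (bΘ'/l)r̂`;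
joint Laplacian comparison `e·(Δω(x) − Δω(y)) ≤ 4bΘ''/l²`; transport `= −(bΘ'/l)⟪u(x) − u(y), r̂⟫`)
`b'Θ − bΘ'ρ·(l'/l) ≤ 4νbΘ''/l² + (bΘ'/l)|⟪δu, x−y⟫|/|x−y| + ⟪δω, δS⟫/|δω|` — OR at some such `t` there is a
SIZE TOUCH: a vorticity argmax `x̄` with `|ω(x̄,t)| = b(t)` and `b'(t) ≤ (α − ν|∇ξ|²_F)(x̄,t)·b(t)` (E1). The
first-exit / compactness structure (decay of `ω, ∇ω` at infinity on closed slabs; the KNV gradient lemma from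
`Θ''(0+) = −∞` excluding the diagonal; `Θ → ∞` excluding far pairs) lives inside the proof. -/
def IncrementEngine : Prop :=
  ∀ (ν T : ℝ) (u : ℝ → (EuclideanSpace ℝ (Fin 3)) → (EuclideanSpace ℝ (Fin 3)))
    (p : ℝ → (EuclideanSpace ℝ (Fin 3)) → ℝ), 0 < ν →
    IsClassicalNSSolutionOn (Ico 0 T) ν 0 u p →
    (∀ T'' < T, HasBoundedSobolevNormsOn (Icc 0 T'') u) →
    ∀ (Θ Θ' Θ'' b b' l l' : ℝ → ℝ) (t₁ t₂ θ₀ : ℝ), IsModulusProfile Θ Θ' Θ'' →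
      0 ≤ t₁ → t₁ < t₂ → t₂ < T → θ₀ < 1 →
      (∀ t ∈ Icc t₁ t₂, HasDerivAt b (b' t) t ∧ HasDerivAt l (l' t) t ∧ 0 < b t ∧ 0 < l t) →
      HasVorticityModulus u Θ t₁ (θ₀ * b t₁) (l t₁) →
      (∀ t ∈ Icc t₁ t₂, HasVorticityModulus u Θ t (b t) (l t)) ∨
      (∃ t ∈ Ioc t₁ t₂, ∃ x y : EuclideanSpace ℝ (Fin 3), x ≠ y ∧ HasVorticityModulus u Θ t (b t) (l t) ∧
        ‖curl (u t) x - curl (u t) y‖ = b t * Θ (‖x - y‖ / l t) ∧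
        b' t * Θ (‖x - y‖ / l t) - b t * Θ' (‖x - y‖ / l t) * (‖x - y‖ / l t) * (l' t / l t) ≤
          4 * ν * b t * Θ'' (‖x - y‖ / l t) / l t ^ 2 +
            b t * Θ' (‖x - y‖ / l t) / l t * |⟪u t x - u t y, x - y⟫| / ‖x - y‖ +
            ⟪curl (u t) x - curl (u t) y,
              fderiv ℝ (u t) x (curl (u t) x) - fderiv ℝ (u t) y (curl (u t) y)⟫ /
              ‖curl (u t) x - curl (u t) y‖) ∨
      (∃ t ∈ Ioc t₁ t₂, ∃ x : EuclideanSpace ℝ (Fin 3), HasVorticityModulus u Θ t (b t) (l t) ∧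
        IsVorticityArgmax u t x ∧ ‖curl (u t) x‖ = b t ∧
        b' t ≤ (⟪vorticityDirection (curl (u t)) x, fderiv ℝ (u t) x (vorticityDirection (curl (u t)) x)⟫ -
          ν * frobeniusNormSq (fderiv ℝ (vorticityDirection (curl (u t))) x)) * b t)

/-- plate D♯ «NearFarSplit» (S; from ns-sfl-p1 g5's `ArgmaxDoorsDepletionBounds` pieces: a local LIPSCHITZ bound
`|ω(y) − ω(x)| ≤ Λ|y − x|` on `B(x,r)` controls the near part of the depletion integral by `4πrΛ`
(`|ω(y) − ⟪ω(y),ξ(x)⟫ξ(x)| ≤ |ω(y) − ω(x)|`, `∫_{B(x,r)}|x−y|⁻² = 4πr`), the rest is the far integral). -/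
def NearFarSplit : Prop :=
  ∀ (ν T : ℝ) (u : ℝ → (EuclideanSpace ℝ (Fin 3)) → (EuclideanSpace ℝ (Fin 3)))
    (p : ℝ → (EuclideanSpace ℝ (Fin 3)) → ℝ),
    IsClassicalNSSolutionOn (Ico 0 T) ν 0 u p →
    (∀ T'' < T, HasBoundedSobolevNormsOn (Icc 0 T'') u) →
    ∀ t ∈ Ico 0 T, ∀ x, curl (u t) x ≠ 0 → ∀ (r Λ : ℝ), 0 < r → 0 ≤ Λ →
      (∀ y, ‖y - x‖ < r → ‖curl (u t) y - curl (u t) x‖ ≤ Λ * ‖y - x‖) →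
      depletionIntegral u t x ≤ 4 * π * r * Λ + farDepletionIntegral u t x r

/-- plate P «ModulusProfileExists» (S; real analysis: e.g. `Θ' = 1/((1+√s)√(1+s))`, `Θ = ∫₀ Θ'` — unbounded
(`Θ' ~ 1/s`), `Θ''(0+) = −∞` (the `−√s` term), `Θ'' < 0`, `Θ' ≤ 1`). Makes the door non-vacuous. -/
def ModulusProfileExists : Prop :=
  ∃ Θ Θ' Θ'' : ℝ → ℝ, IsModulusProfile Θ Θ' Θ''

end Summit.NavierStokesRegularity.NavierStokesRegularity.Theorems.IncrementDoors

end
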